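import Mathlib
import Summits.NavierStokesRegularity.NavierStokesRegularity.Theorems.WakeRatchetTailRatchetPostFiringOfUnimodal
import Summits.NavierStokesRegularity.NavierStokesRegularity.Theorems.WakeRatchetTailRatchetPeakDelaySelfDrain
import HarnessLib

/-!
# `WakeRatchet.TailRatchet` (stmt-NavierStokesRegularity-21808), door D4′ — the RISING-CHAIN reduction:
# (U) unimodality + (O) ordered peaks + a rising chain of bounded length holding its level with small look-ahead
# ⟹ (R′) peak delay ⟹ (D) `DyadicCauchyPostFiringBound` ⟹ ¬ TailRatchet

Def-free bookkeeping (`--supports stmt-NavierStokesRegularity-21808`).  The tree reduces the refutation of `TailRatchet`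
to the post-firing bound (D) for the one-shell non-negative dyadic cascade `Ẋₙ = Λⁿ⁻¹Xₙ₋₁² − ΛⁿXₙXₙ₊₁`
(`TailRatchet_false_of_DyadicCauchyPostFiringBound`, p839011), and (D) to (U) + (R′)
(`cauchyPostFiringBound_of_unimodal`, p840254).  Iterating the one-step self-drain lemma
`WakeRatchetPeakDelaySelfDrain.dyadic_peak_delay_bottom_shell` (p840465) up the chain of rising shells gives (R′) from the
following FRONT-STRUCTURE data of the Cauchy bundle at a fixed scale ratio (each numerically true at Λ ∈ [1.08, 1.5],
CENSUS-21808-leafhand4-g20.md; none proved here):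

* (U) peak times `pₙ ∈ [0,T*)` with `Xₙ` non-decreasing on `[0,pₙ]`, non-increasing on `[pₙ,T*)`;
* (O) `pₙ ≤ pₙ₊₁`;
* (CH) RISING CHAIN of length `< J` at level `c > 0`: whenever shell `n` is at renormalised level `≥ c₀ = 1/(2(Λ+Λ⁻¹))`
  at a time `t < pₙ`, there is `j₀ < J` with `p_{n−j₀−1} ≤ t` (the shell below the chain has peaked) and, for every chain
  shell `k ∈ [n−j₀, n]`: `t ≤ pₖ`, the level `ΛᵏXₖ(τ)(T*−τ) ≥ c` and the look-ahead bound `ΛXₖ₊₁Xₖ₊₂ ≤ Xₖ²/2` hold on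
  `[t, pₖ]` (numerically `J = 3`, `c = c₀`, look-ahead ≤ 0.30).

Results: `peakDelay_of_risingChain` — (U)+(O)+(CH) ⟹ (R′) with `K = (2 + 4ΛK_I²/c³)^J`, `K_I = 2Λ²/(Λ−1)²` the bundle's
type-I constant; `cauchyPostFiringBound_of_risingChain` — ⟹ (D); `TailRatchet_false_of_risingChain` — ⟹ ¬ TailRatchet.

HONEST FRAMING: MODEL lattice ODEs (Tao 2016 §1.2, §4); bookkeeping only — (U), (O), (CH) are NOT proved, (D) is not
proved, stmt-21808 is neither proved nor refuted, no stub of skeleton d00b85951d7c is closed; rung 0.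
-/

noncomputable section

set_option linter.dupNamespace false

namespace Summit.NavierStokesRegularity.NavierStokesRegularity.Theorems

namespace WakeRatchetPeakDelaySelfDrain

open Set
open Literature.Analysis.FluidPDE Literature.Analysis.FluidPDE.TaoCascade
open WakeRatchetDyadicPostFiring

/-- **Chain iteration (abstract, one bundle).**  For a non-negative solution `X` of the dyadic law on `[0,T*)` with the
type-I bound `ΛⁿXₙ(t)(T*−t) ≤ K_I`, unimodal shells with ordered peak times `p`, and a rising chain
`k₀ = n − j₀, …, n` above a peaked shell (`p_{k₀−1} ≤ t ≤ pₖ`, level `≥ c` and look-ahead `≤ ½` on `[t,pₖ]` for every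
chain shell): `T* − t ≤ C^{j₀+1}(T* − pₙ)` with `C = 2 + 4ΛK_I²/c³`.
[cite: Tao2016AveragedNS, §1.2 (dyadic model), §4 Lemma 4.1 (4.8); elementary (door D4′ of stmt-21808)] -/
theorem chain_iterate {X : ℤ → ℝ → ℝ} {Λ KI c Tstar δ t : ℝ} {p : ℤ → ℝ} {n : ℤ} {j₀ : ℕ}
    (hΛ : 0 < Λ) (hc : 0 < c) (hδ : 0 < δ)
    (hlaw : ∀ m : ℤ, ∀ τ ∈ Ioo (-δ) Tstar,
      HasDerivAt (X m) (Λ ^ (m - 1) * X (m - 1) τ ^ 2 - Λ ^ m * X m τ * X (m + 1) τ) τ)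
    (hnn : ∀ m : ℤ, ∀ τ ∈ Ico 0 Tstar, 0 ≤ X m τ)
    (htypeI : ∀ m : ℤ, ∀ τ ∈ Ico 0 Tstar, Λ ^ m * X m τ * (Tstar - τ) ≤ KI)
    (hU : ∀ m : ℤ, p m ∈ Ico 0 Tstar ∧ MonotoneOn (X m) (Icc 0 (p m)) ∧ AntitoneOn (X m) (Ico (p m) Tstar))
    (hO : ∀ m : ℤ, p m ≤ p (m + 1))
    (ht : t ∈ Ico 0 Tstar) (hbot : p (n - j₀ - 1) ≤ t)
    (hch : ∀ k : ℤ, n - j₀ ≤ k → k ≤ n → t ≤ p k ∧ ∀ τ ∈ Icc t (p k),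
      c ≤ Λ ^ k * X k τ * (Tstar - τ) ∧ Λ * X (k + 1) τ * X (k + 2) τ ≤ X k τ ^ 2 / 2) :
    Tstar - t ≤ (2 + 4 * Λ * KI ^ 2 / c ^ 3) ^ (j₀ + 1) * (Tstar - p n) := by
  set C : ℝ := 2 + 4 * Λ * KI ^ 2 / c ^ 3 with hC
  have hC0 : 0 ≤ C := by positivity
  -- the one-step lemma on an interval [a, p k] with the shell below peaked at or before a
  have step : ∀ (k : ℤ) (a : ℝ), n - j₀ ≤ k → k ≤ n → a ∈ Ico 0 Tstar → t ≤ a → a ≤ p k → p (k - 1) ≤ a →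
      Tstar - a ≤ C * (Tstar - p k) := by
    intro k a hk1 hk2 ha hta hap hpk
    obtain ⟨hpkI, hmono, hanti⟩ := hU k
    obtain ⟨-, -, hantim⟩ := hU (k - 1)
    have hsubI : ∀ τ ∈ Icc a (p k), τ ∈ Ioo (-δ) Tstar := fun τ hτ =>
      ⟨by linarith [ha.1, hτ.1], lt_of_le_of_lt hτ.2 hpkI.2⟩
    have hsub0 : ∀ τ ∈ Icc a (p k), τ ∈ Ico 0 Tstar := fun τ hτ =>
      ⟨ha.1.trans hτ.1, lt_of_le_of_lt hτ.2 hpkI.2⟩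
    obtain ⟨htk, hchk⟩ := hch k hk1 hk2
    refine dyadic_peak_delay_bottom_shell (X := X) (k := k) hΛ hc hap hpkI.2 ?_ ?_ ?_ ?_ (htypeI (k - 1) a ha) ?_ ?_ ?_
    · intro τ hτ; exact hlaw k τ (hsubI τ hτ)
    · intro τ hτ
      have h := hlaw (k + 1) τ (hsubI τ hτ)
      have e1 : k + 1 - 1 = k := by ring
      have e2 : k + 1 + 1 = k + 2 := by ring
      rw [e1, e2] at h
      exact h
    · intro j τ hτ; exact hnn j τ (hsub0 τ hτ)
    · intro τ hτ
      exact hantim ⟨hpk, ha.2⟩ ⟨hpk.trans hτ.1, (hsub0 τ hτ).2⟩ hτ.1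
    · intro τ hτ; exact (hchk τ ⟨hta.trans hτ.1, hτ.2⟩).2
    · intro τ hτ; exact (hchk τ ⟨hta.trans hτ.1, hτ.2⟩).1
    · exact hmono ⟨ha.1, hap⟩ ⟨hpkI.1, le_rfl⟩ hap
  -- induction up the chain
  have main : ∀ j : ℕ, j ≤ j₀ → Tstar - t ≤ C ^ (j + 1) * (Tstar - p (n - j₀ + j)) := by
    intro j
    induction j with
    | zero =>
      intro _
      have hk : n - (j₀ : ℤ) + ((0 : ℕ) : ℤ) = n - j₀ := by push_cast; ring
      rw [hk, zero_add, pow_one]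
      have htk := (hch (n - j₀) le_rfl (by linarith [(Nat.cast_nonneg j₀ : (0 : ℝ) ≤ j₀)] )).1
      refine step (n - j₀) t le_rfl (by
        have : (0 : ℤ) ≤ j₀ := Int.natCast_nonneg j₀
        linarith) ht le_rfl htk (by
          have e : n - (j₀ : ℤ) - 1 = n - j₀ - 1 := rfl
          exact hbot)
    | succ j ih =>
      intro hj
      have hj' : j ≤ j₀ := Nat.le_of_succ_le hj
      have h1 := ih hj'
      set k : ℤ := n - j₀ + j with hk
      have hk1 : n - j₀ ≤ k := by
        have : (0 : ℤ) ≤ j := Int.natCast_nonneg j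
        rw [hk]; linarith
      have hk2 : k + 1 ≤ n := by
        have : (j : ℤ) + 1 ≤ j₀ := by exact_mod_cast hj
        rw [hk]; linarith
      have hpk : p k ∈ Ico 0 Tstar := (hU k).1
      have htk : t ≤ p k := (hch k hk1 (by linarith)).1
      have h2 := step (k + 1) (p k) (by linarith) hk2 hpk htk (hO k) (by rw [add_sub_cancel_right])
      have e : n - (j₀ : ℤ) + ((j + 1 : ℕ) : ℤ) = k + 1 := by rw [hk]; push_cast; ring
      rw [e, pow_succ]
      calc Tstar - t ≤ C ^ (j + 1) * (Tstar - p k) := h1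
        _ ≤ C ^ (j + 1) * (C * (Tstar - p (k + 1))) := mul_le_mul_of_nonneg_left h2 (pow_nonneg hC0 _)
        _ = C ^ (j + 1) * C * (Tstar - p (k + 1)) := by ring
  have h := main j₀ le_rfl
  have e : n - (j₀ : ℤ) + (j₀ : ℤ) = n := by ring
  rw [e] at h
  exact h

/-- **(U) + (O) + (CH) ⟹ (R′), for one bundle.**  With the data of `chain_iterate` available at EVERY pre-peak time of
renormalised level `≥ c₀` (chain length `< J`), every shell obeys the peak delay `T* − t ≤ K(T* − pₙ)` whenever
`ΛⁿXₙ(t)(T*−t) ≥ c₀`, with `K = (2 + 4ΛK_I²/c³)^J`.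
[cite: Tao2016AveragedNS, §1.2 (dyadic model), §4 Lemma 4.1 (4.8); elementary (door D4′ of stmt-21808)] -/
theorem peakDelay_of_risingChain {X : ℤ → ℝ → ℝ} {Λ KI c c₀ Tstar δ : ℝ} {p : ℤ → ℝ} {J : ℕ}
    (hΛ : 0 < Λ) (hc : 0 < c) (hδ : 0 < δ)
    (hlaw : ∀ m : ℤ, ∀ τ ∈ Ioo (-δ) Tstar,
      HasDerivAt (X m) (Λ ^ (m - 1) * X (m - 1) τ ^ 2 - Λ ^ m * X m τ * X (m + 1) τ) τ)
    (hnn : ∀ m : ℤ, ∀ τ ∈ Ico 0 Tstar, 0 ≤ X m τ)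
    (htypeI : ∀ m : ℤ, ∀ τ ∈ Ico 0 Tstar, Λ ^ m * X m τ * (Tstar - τ) ≤ KI)
    (hU : ∀ m : ℤ, p m ∈ Ico 0 Tstar ∧ MonotoneOn (X m) (Icc 0 (p m)) ∧ AntitoneOn (X m) (Ico (p m) Tstar))
    (hO : ∀ m : ℤ, p m ≤ p (m + 1))
    (hCH : ∀ (n : ℤ) (t : ℝ), t ∈ Ico 0 Tstar → c₀ ≤ Λ ^ n * X n t * (Tstar - t) → t < p n →
      ∃ j₀ : ℕ, j₀ < J ∧ p (n - j₀ - 1) ≤ t ∧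
        ∀ k : ℤ, n - j₀ ≤ k → k ≤ n → t ≤ p k ∧ ∀ τ ∈ Icc t (p k),
          c ≤ Λ ^ k * X k τ * (Tstar - τ) ∧ Λ * X (k + 1) τ * X (k + 2) τ ≤ X k τ ^ 2 / 2) :
    ∀ (n : ℤ), ∀ t ∈ Ico 0 Tstar, c₀ ≤ Λ ^ n * X n t * (Tstar - t) →
      Tstar - t ≤ (2 + 4 * Λ * KI ^ 2 / c ^ 3) ^ J * (Tstar - p n) := by
  intro n t ht hlev
  set C : ℝ := 2 + 4 * Λ * KI ^ 2 / c ^ 3 with hC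
  have hC1 : 1 ≤ C := by
    have : 0 ≤ 4 * Λ * KI ^ 2 / c ^ 3 := by positivity
    linarith
  have hpn : p n < Tstar := (hU n).1.2
  rcases le_or_gt (p n) t with hle | hlt
  · -- after the peak: trivial
    have h1 : Tstar - t ≤ Tstar - p n := by linarith
    have h2 : Tstar - p n ≤ C ^ J * (Tstar - p n) :=
      le_mul_of_one_le_left (by linarith) (one_le_pow₀ hC1)
    exact h1.trans h2
  · obtain ⟨j₀, hj₀, hbot, hch⟩ := hCH n t ht hlev hlt
    have h := chain_iterate hΛ hc hδ hlaw hnn htypeI hU hO ht hbot hch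
    have h2 : C ^ (j₀ + 1) ≤ C ^ J := pow_le_pow_right₀ hC1 (by omega)
    exact h.trans (mul_le_mul_of_nonneg_right h2 (by linarith))

/-- **(U) + (O) + (CH) at arbitrarily small scale ratios ⟹ (D).**  If at arbitrarily small `ε₀` every Cauchy bundle of
`DyadicCauchyPostFiringBound` carries peak times with (U), (O) and a rising chain of bounded length holding a level `c > 0`
with look-ahead `≤ ½` (CH), then (D) `DyadicCauchyPostFiringBound` holds (via `peakDelay_of_risingChain` and the tree's
`cauchyPostFiringBound_of_unimodal`).
[cite: Tao2016AveragedNS, §1.2 (dyadic model), §4 Lemma 4.1 (4.8), §6.4; cell vocabulary (door D4′ of stmt-21808)] -/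
theorem cauchyPostFiringBound_of_risingChain
    (H : ∀ ε : ℝ, 0 < ε → ∃ ε₀ : ℝ, 0 < ε₀ ∧ ε₀ ≤ ε ∧
      ∀ (Tstar : ℝ) (X : ℤ → ℝ → ℝ), 0 < Tstar →
        (∀ n : ℤ, X n 0 = if n = 0 then 1 else 0) →
        (∀ n : ℤ, ∀ t ∈ Ioo (-(1 / ((bigLam ε₀ + (bigLam ε₀)⁻¹) * (1 + 1) ^ 2 + 1))) Tstar,
          HasDerivAt (X n) (bigLam ε₀ ^ (n - 1) * X (n - 1) t ^ 2 - bigLam ε₀ ^ n * X n t * X (n + 1) t) t) →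
        (∀ T', T' < Tstar → ∃ B : ℝ, ∀ n : ℤ,
          ∀ t ∈ Ioo (-(1 / ((bigLam ε₀ + (bigLam ε₀)⁻¹) * (1 + 1) ^ 2 + 1))) T', |bigLam ε₀ ^ n * X n t| ≤ B) →
        (∀ n : ℤ, ∀ t ∈ Ico 0 Tstar, 0 ≤ X n t) →
        (∀ n : ℤ, ∀ t ∈ Ico 0 Tstar,
          bigLam ε₀ ^ n * X n t * (Tstar - t) ≤ 2 * bigLam ε₀ ^ 2 / (bigLam ε₀ - 1) ^ 2) →
        (∀ t ∈ Ioo (-(1 / ((bigLam ε₀ + (bigLam ε₀)⁻¹) * (1 + 1) ^ 2 + 1))) Tstar, ∀ β : ℝ, 0 < β →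
          (∀ n : ℤ, |bigLam ε₀ ^ n * X n t| ≤ β) → 1 ≤ (bigLam ε₀ + (bigLam ε₀)⁻¹) * β * (Tstar - t)) →
        ∃ (p : ℤ → ℝ) (c : ℝ) (J : ℕ), 0 < c ∧
          (∀ m : ℤ, p m ∈ Ico 0 Tstar ∧ MonotoneOn (X m) (Icc 0 (p m)) ∧ AntitoneOn (X m) (Ico (p m) Tstar)) ∧
          (∀ m : ℤ, p m ≤ p (m + 1)) ∧
          (∀ (n : ℤ) (t : ℝ), t ∈ Ico 0 Tstar →
            1 / (2 * (bigLam ε₀ + (bigLam ε₀)⁻¹)) ≤ bigLam ε₀ ^ n * X n t * (Tstar - t) → t < p n →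
            ∃ j₀ : ℕ, j₀ < J ∧ p (n - j₀ - 1) ≤ t ∧
              ∀ k : ℤ, n - j₀ ≤ k → k ≤ n → t ≤ p k ∧ ∀ τ ∈ Icc t (p k),
                c ≤ bigLam ε₀ ^ k * X k τ * (Tstar - τ) ∧
                bigLam ε₀ * X (k + 1) τ * X (k + 2) τ ≤ X k τ ^ 2 / 2)) :
    DyadicCauchyPostFiringBound := by
  refine cauchyPostFiringBound_of_unimodal fun ε hε => ?_
  obtain ⟨ε₀, hε₀, hle, H'⟩ := H ε hε
  refine ⟨ε₀, hε₀, hle, ?_⟩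
  intro Tstar X hT h0 hlaw hreg hnn htypeI hlow
  obtain ⟨p, c, J, hc, hU, hO, hCH⟩ := H' Tstar X hT h0 hlaw hreg hnn htypeI hlow
  have hΛ : 0 < bigLam ε₀ := bigLam_pos (by linarith)
  have hδ : 0 < 1 / ((bigLam ε₀ + (bigLam ε₀)⁻¹) * (1 + 1) ^ 2 + 1) := by
    have : 0 < (bigLam ε₀)⁻¹ := inv_pos.2 hΛ
    positivity
  have hR := peakDelay_of_risingChain hΛ hc hδ hlaw hnn htypeI hU hO hCH
  exact ⟨(2 + 4 * bigLam ε₀ * (2 * bigLam ε₀ ^ 2 / (bigLam ε₀ - 1) ^ 2) ^ 2 / c ^ 3) ^ J,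
    fun n => ⟨p n, (hU n).1, (hU n).2.1, (hU n).2.2, fun t ht hlev => hR n t ht hlev⟩⟩

/-- **(U) + (O) + (CH) at arbitrarily small scale ratios ⟹ ¬ TailRatchet** (composition with the tree's
`TailRatchet_false_of_DyadicCauchyPostFiringBound`).  Conditional refutation; nothing is settled.
[cite: Tao2016AveragedNS, §1.2 (dyadic model), §4 Lemma 4.1 (4.8), §6.4; cell vocabulary (door D4′ of stmt-21808)] -/
theorem TailRatchet_false_of_risingChain
    (H : ∀ ε : ℝ, 0 < ε → ∃ ε₀ : ℝ, 0 < ε₀ ∧ ε₀ ≤ ε ∧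
      ∀ (Tstar : ℝ) (X : ℤ → ℝ → ℝ), 0 < Tstar →
        (∀ n : ℤ, X n 0 = if n = 0 then 1 else 0) →
        (∀ n : ℤ, ∀ t ∈ Ioo (-(1 / ((bigLam ε₀ + (bigLam ε₀)⁻¹) * (1 + 1) ^ 2 + 1))) Tstar,
          HasDerivAt (X n) (bigLam ε₀ ^ (n - 1) * X (n - 1) t ^ 2 - bigLam ε₀ ^ n * X n t * X (n + 1) t) t) →
        (∀ T', T' < Tstar → ∃ B : ℝ, ∀ n : ℤ,
          ∀ t ∈ Ioo (-(1 / ((bigLam ε₀ + (bigLam ε₀)⁻¹) * (1 + 1) ^ 2 + 1))) T', |bigLam ε₀ ^ n * X n t| ≤ B) →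
        (∀ n : ℤ, ∀ t ∈ Ico 0 Tstar, 0 ≤ X n t) →
        (∀ n : ℤ, ∀ t ∈ Ico 0 Tstar,
          bigLam ε₀ ^ n * X n t * (Tstar - t) ≤ 2 * bigLam ε₀ ^ 2 / (bigLam ε₀ - 1) ^ 2) →
        (∀ t ∈ Ioo (-(1 / ((bigLam ε₀ + (bigLam ε₀)⁻¹) * (1 + 1) ^ 2 + 1))) Tstar, ∀ β : ℝ, 0 < β →
          (∀ n : ℤ, |bigLam ε₀ ^ n * X n t| ≤ β) → 1 ≤ (bigLam ε₀ + (bigLam ε₀)⁻¹) * β * (Tstar - t)) →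
        ∃ (p : ℤ → ℝ) (c : ℝ) (J : ℕ), 0 < c ∧
          (∀ m : ℤ, p m ∈ Ico 0 Tstar ∧ MonotoneOn (X m) (Icc 0 (p m)) ∧ AntitoneOn (X m) (Ico (p m) Tstar)) ∧
          (∀ m : ℤ, p m ≤ p (m + 1)) ∧
          (∀ (n : ℤ) (t : ℝ), t ∈ Ico 0 Tstar →
            1 / (2 * (bigLam ε₀ + (bigLam ε₀)⁻¹)) ≤ bigLam ε₀ ^ n * X n t * (Tstar - t) → t < p n →
            ∃ j₀ : ℕ, j₀ < J ∧ p (n - j₀ - 1) ≤ t ∧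
              ∀ k : ℤ, n - j₀ ≤ k → k ≤ n → t ≤ p k ∧ ∀ τ ∈ Icc t (p k),
                c ≤ bigLam ε₀ ^ k * X k τ * (Tstar - τ) ∧
                bigLam ε₀ * X (k + 1) τ * X (k + 2) τ ≤ X k τ ^ 2 / 2)) :
    ¬ Summit.NavierStokesRegularity.NavierStokesRegularity.Theses.WakeRatchet.TailRatchet :=
  TailRatchet_false_of_DyadicCauchyPostFiringBound (cauchyPostFiringBound_of_risingChain H)

end WakeRatchetPeakDelaySelfDrain

end Summit.NavierStokesRegularity.NavierStokesRegularity.Theorems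

end
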